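import Literature.Barriers.ValiantsHypothesis.PlethysmTransposeMachine
import Literature.Barriers.ValiantsHypothesis.PlethysmHardnessThree
import Literature.RepresentationTheory.GeneralLinear.WreathPrepend
import Literature.RepresentationTheory.GeneralLinear.PlethysmWordModel
import HarnessLib

/-!
# PLETHYSMPOSITIVITY(`m`) is NP-hard for every fixed `m ≥ 3`, and PLETHYSMPOSITIVITY is NP-hard
# (Fischer–Ikenmeyer 2020, Thm. 1): discharge of `FischerIkenmeyer2020_plethysmNPHard` and of the
# barrier fact `KroneckerPlethysmHardness`

N. Fischer, C. Ikenmeyer, *The computational complexity of plethysm coefficients*, Comput.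
Complexity 29 (2020) 8, Thm. 1: "PLETHYSMPOSITIVITY(`m`) and DUALPLETHYSMPOSITIVITY(`m`) are NP-hard
for any fixed `m ≥ 3`. In particular, PLETHYSMPOSITIVITY and DUALPLETHYSMPOSITIVITY are NP-hard."
Printed proof: §6 (Fig. 2: `2D-X-RAY → … → (DUAL)PLETHYSM(3)`, Lemmas 4–8) for `m = 3`, and Lemma 1
(Facts 1 and 2: `a_λ(n, m) = b_π(n, m+1)`, `b_λ(n, m) = a_{π'}(n, m+1)`) to climb to every `m ≥ 3`.

**The chain in the tree's model.** All languages below code a pair `(n, μ)` as the list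
`n :: μ.sortedParts` under `encodingComposition` (`wreathLangL m χ`: the pairs whose space of
`χ n`-isotypic highest-weight vectors of weight `μ` in `(ℂ^{nm})^{⊗nm}` is nonzero — the word model of
`Symⁿ/Λⁿ Symᵐ/Λᵐ`, `WreathHighestWeight.lean`). With `innerSignChar n m b` the inner-antisymmetric
characters (`b = false`: `s`; `b = true`: `s·σₒ`, `WreathPrepend.lean`):

* base `m = 3`: `wreathLangL 3 (s)` ← SKEW-SYMMETRIC-2D-X-RAY (open cone, FI Thm. 4 for `a_λ(n,3)`,
  `PlethysmHardnessThree.lean` + `convLF`) and `wreathLangL 3 (s·σₒ)` ← SYMMETRIC-2D-X-RAY (closed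
  cone: `b_μ(n,3)` is the `σₒ`-multiplicity of `μ`, i.e. by Fact 1 the `s·σₒ`-multiplicity of `μᵀ`;
  machine `convLTF` outputs `(n, μᵀ)`);
* step `m ↦ m + 1` (Lemma 1 / Fact 2, `WreathPrepend.lean`): `wreathLangL m (isc b) ≤ₚ
  wreathLangL (m+1) (isc !b)` by the machine `prependF` (`(n, μ) ↦ (n, (n, μ))`);
* exit (Fact 1, `PlethysmWordModel.lean`: `a_λ(n,m) > 0 ↔ wreathHW (s) λᵀ ≠ ⊥`):
  `wreathLangL m (s) ≤ₚ PlethysmPositivityFixed m` by `transOutF m` (`(n, μ) ↦ ⟨μᵀ, n⟩` in the barrier's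
  coding), and `wreathLangL 3 (s) ≤ₚ PlethysmPositivity` by appending `unaryNat 3`.

Hence `isNPHard_plethysmPositivityFixed` (`m ≥ 3`), `isNPHard_plethysmPositivity`,
**`FischerIkenmeyer2020_plethysmNPHard_holds`**, and — with the Kronecker half
`IMW2017_kroneckerNPHard_holds` (`KroneckerXRayMachine.lean`) — **`KroneckerPlethysmHardness_holds`**.
The complexity leaves (Cook–Levin, SAT → 3SAT → 1-IN-3-SAT → 2D-X-RAY, FI Lemmas 5 and 8) and the
representation theory (Schur–Weyl, Fact 1, Fact 2, Thm. 4) are all theorems of the tree; no named fact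
is used.

## References

* [FischerIkenmeyer2020] Thm. 1; §2 (Fact 1); §4 (Lemma 1, Fact 2); §5 (Thm. 4); §6 (Lemmas 3–8).
* [IkenmeyerMulmuleyWalter2017] Thm. 1.1 (the Kronecker half of the barrier).
-/

noncomputable section

open scoped BigOperators

namespace Literature.Barriers.ValiantsHypothesis

open Literature.Computability.Complexity Literature.Computability.Complexity.Tomography
open Literature.NumberTheory.DiophantineGeometry Literature.RepresentationTheory.GeneralLinear
open Literature.Computability.AlgebraicComplexity Literature.Computability.Complexity.Brick
open scoped Literature.Computability.Complexity.Notation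

/-! ### Partition bookkeeping -/

namespace PlethCode

/-- Lists of positive naturals with the same `getD · 0` everywhere are equal. [folklore] -/
theorem eq_of_getD_eq : ∀ {l₁ l₂ : List ℕ}, (∀ a ∈ l₁, 0 < a) → (∀ a ∈ l₂, 0 < a) →
    (∀ i, l₁.getD i 0 = l₂.getD i 0) → l₁ = l₂
  | [], [], _, _, _ => rfl
  | [], b :: t, _, h2, h => by have := h 0; simp at this; have := h2 b (by simp); omega
  | a :: t, [], h1, _, h => by have := h 0; simp at this; have := h1 a (by simp); omega
  | a :: t, b :: t', h1, h2, h => by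
    have h0 := h 0
    simp at h0
    subst h0
    congr 1
    exact eq_of_getD_eq (fun x hx => h1 x (by simp [hx])) (fun x hx => h2 x (by simp [hx]))
      fun i => by have := h (i + 1); simpa using this

/-- The sorted parts, read as a composition, form an antitone sequence. [folklore] -/
theorem antitone_listFn_sortedParts {d : ℕ} (μ : Nat.Partition d) : Antitone (listFn μ.sortedParts) := by
  have hp : μ.sortedParts.Pairwise (· ≥ ·) := List.sortedGE_iff_pairwise.mp μ.sortedGE_sortedParts
  refine antitone_nat_of_succ_le fun j => ?_
  by_cases hj1 : j + 1 < μ.sortedParts.length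
  · have hj : j < μ.sortedParts.length := by omega
    rw [listFn_of_lt hj, listFn_of_lt hj1]
    exact List.pairwise_iff_getElem.mp hp j (j + 1) hj hj1 (Nat.lt_succ_self j)
  · rw [listFn_of_le (l := μ.sortedParts) (i := j + 1) (by omega)]
    exact Nat.zero_le _

/-- **The transpose in terms of the sorted parts**: `μᵀ.sortedParts = rowCounts μ.sortedParts`
(`c_j = #{i : j < μ_i}`, the column lengths), via the tree's `sortedParts_transpose_partitionOfRows`.
[cite: IkenmeyerMulmuleyWalter2017, §1.1 (λᵀ)] -/
theorem sortedParts_transpose_eq_rowCounts {d : ℕ} (μ : Nat.Partition d) :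
    μ.transpose.sortedParts = rowCounts (listFn μ.sortedParts) μ.sortedParts.length := by
  set sp := μ.sortedParts with hsp
  have hX : Antitone (listFn sp) := antitone_listFn_sortedParts μ
  have hsum : ∑ i ∈ Finset.range sp.length, listFn sp i = d := by
    rw [← sum_eq_sum_range_listFn, hsp, μ.sum_sortedParts]
  rcases Nat.eq_zero_or_pos sp.length with h0 | hpos
  · -- no parts: `d = 0`, both sides empty
    have hd : d = 0 := by rw [← hsum, h0, Finset.sum_range_zero]
    subst hd
    have h1 : μ.transpose.sortedParts = [] := List.eq_nil_of_length_eq_zero (by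
      rw [Nat.Partition.length_sortedParts]; exact Nat.le_zero.mp (Nat.Partition.card_parts_le_size _))
    have h2 : listFn sp 0 = 0 := listFn_of_le (by omega)
    rw [h1, rowCounts, h2, List.range_zero, List.map_nil]
  · have hP : partitionOfRows (listFn sp) sp.length d = μ := by
      apply eq_of_sortedParts_eq
      apply eq_of_getD_eq (fun a ha => Nat.Partition.pos_of_mem_sortedParts _ ha)
        (fun a ha => Nat.Partition.pos_of_mem_sortedParts _ ha)
      intro i
      rw [getD_sortedParts_partitionOfRows hX hsum i]
      change _ = listFn sp i
      by_cases hi : i < sp.length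
      · rw [if_pos hi]
      · rw [if_neg hi, listFn_of_le (not_lt.mp hi)]
    rw [← sortedParts_transpose_partitionOfRows hX hpos hsum, hP]

/-- The partition with sorted parts a given valid list `L` (weakly decreasing, no zeros, sum `D`).
[cite: FischerIkenmeyer2020, §2 (partitions)] -/
def partOfList (L : List ℕ) (hpos : ∀ j < L.length, listFn L j ≠ 0) (D : ℕ) (hsum : L.sum = D) : Nat.Partition D where
  parts := (L : Multiset ℕ)
  parts_pos ha := by
    obtain ⟨j, hj, rfl⟩ := List.getElem_of_mem (Multiset.mem_coe.1 ha)
    have := hpos j hj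
    rw [listFn_of_lt hj] at this
    exact Nat.pos_of_ne_zero this
  parts_sum := by rw [Multiset.sum_coe, hsum]

/-- Its sorted parts are `L`. [folklore] -/
theorem sortedParts_partOfList {L : List ℕ} (ha : AntiL L) (hpos : ∀ j < L.length, listFn L j ≠ 0) (D : ℕ)
    (hsum : L.sum = D) : (partOfList L hpos D hsum).sortedParts = L := by
  have hp : (partOfList L hpos D hsum).sortedParts.Perm L := Quotient.exact (Multiset.sort_eq _ _)
  exact hp.eq_of_sortedGE (Nat.Partition.sortedGE_sortedParts _)
    (List.sortedGE_iff_pairwise.mpr (pairwise_ge (antitone_listFn ha)))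

/-- The sorted parts of a partition form a valid list (`ValidL`) for the product of its sizes. [folklore] -/
theorem validL_sortedParts {n m : ℕ} (μ : Nat.Partition (n * m)) : ValidL m n μ.sortedParts := by
  refine ⟨antiL_of_antitone (antitone_listFn_sortedParts μ), fun j hj => ?_, by rw [μ.sum_sortedParts, Nat.mul_comm]⟩
  rw [listFn_of_lt hj]
  exact (μ.pos_of_mem_sortedParts (List.getElem_mem hj)).ne'

/-- **Prepending the part `n`** (`n > 0`) to a partition of `n·m`: a partition of `n·(m+1)`.
[cite: FischerIkenmeyer2020, §4 (Fact 2: "prepending a row of width n to λ")] -/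
def consPart {n m : ℕ} (hn : 0 < n) (μ : Nat.Partition (n * m)) : Nat.Partition (n * (m + 1)) where
  parts := n ::ₘ μ.parts
  parts_pos ha := by
    rcases Multiset.mem_cons.1 ha with rfl | ha
    · exact hn
    · exact μ.parts_pos ha
  parts_sum := by rw [Multiset.sum_cons, μ.parts_sum]; ring

/-- If `n ≥ μ₁`, the sorted parts of `consPart` are `n :: μ.sortedParts`. [folklore] -/
theorem sortedParts_consPart {n m : ℕ} (hn : 0 < n) (μ : Nat.Partition (n * m)) (hle : listFn μ.sortedParts 0 ≤ n) :
    (consPart hn μ).sortedParts = n :: μ.sortedParts := by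
  have hp : (consPart hn μ).sortedParts.Perm (n :: μ.sortedParts) := by
    apply Multiset.coe_eq_coe.mp
    rw [Nat.Partition.sortedParts, Multiset.sort_eq, ← Multiset.cons_coe, Nat.Partition.sortedParts, Multiset.sort_eq]
    rfl
  refine hp.eq_of_sortedGE (Nat.Partition.sortedGE_sortedParts _) (List.sortedGE_iff_pairwise.mpr ?_)
  rw [List.pairwise_cons]
  refine ⟨fun a ha => ?_, List.sortedGE_iff_pairwise.mp μ.sortedGE_sortedParts⟩
  obtain ⟨j, hj, rfl⟩ := List.getElem_of_mem ha
  have h := antitone_listFn_sortedParts μ (Nat.zero_le j)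
  rw [listFn_of_lt hj] at h
  exact h.trans hle

/-- The weight of `consPart`: `(n, μ)` = `Fin.cons n (weight of μ)`. [folklore] -/
theorem ofPartition_consPart {n m : ℕ} (hn : 0 < n) (μ : Nat.Partition (n * m)) (hle : listFn μ.sortedParts 0 ≤ n) (M : ℕ) :
    Weight.ofPartition (M + 1) (consPart hn μ) = Fin.cons (n : ℤ) (Weight.ofPartition M μ) := by
  funext i
  refine Fin.cases ?_ (fun j => ?_) i
  · simp [Weight.ofPartition, sortedParts_consPart hn μ hle]
  · simp [Weight.ofPartition, sortedParts_consPart hn μ hle]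

/-- **Removing the first part**: if `μ' ⊢ n(m+1)` has sorted parts `n :: L`, then `L` are the sorted parts
of a partition of `n·m`. [cite: FischerIkenmeyer2020, §4 (Fact 2)] -/
theorem exists_tail_partition {n m : ℕ} (μ' : Nat.Partition (n * (m + 1))) {L : List ℕ}
    (h : μ'.sortedParts = n :: L) : ∃ μ : Nat.Partition (n * m), μ.sortedParts = L := by
  have hv := validL_sortedParts μ'
  rw [h] at hv
  obtain ⟨ha, hpos, hsum⟩ := hv
  have haL : AntiL L := fun j hj => by
    have := ha (j + 1) (by simp; omega)
    exact this
  have hposL : ∀ j < L.length, listFn L j ≠ 0 := fun j hj => hpos (j + 1) (by simp; omega)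
  have hsumL : L.sum = n * m := by
    rw [List.sum_cons] at hsum
    have e1 : (m + 1) * n = n + n * m := by ring
    omega
  exact ⟨partOfList L hposL (n * m) hsumL, sortedParts_partOfList haL hposL _ hsumL⟩

/-- All partitions of `0` have the zero weight. [folklore] -/
theorem ofPartition_of_size_zero {d : ℕ} (hd : d = 0) (μ : Nat.Partition d) (N : ℕ) :
    Weight.ofPartition N μ = fun _ => 0 := by
  subst hd
  have h1 : μ.sortedParts = [] := List.eq_nil_of_length_eq_zero (by
    rw [Nat.Partition.length_sortedParts]; exact Nat.le_zero.mp (Nat.Partition.card_parts_le_size _))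
  funext i
  simp [Weight.ofPartition, h1]

end PlethCode

/-! ### The list-coded languages of the chain -/

/-- The pairs `(n, μ)`, `μ ⊢ n·m`, with a nonzero space of `χ n`-isotypic highest-weight vectors of weight
`μ`, as lists `n :: μ.sortedParts`. [cite: FischerIkenmeyer2020, §2 (eq. (2), Fact 1)] -/
def wreathSetL (m : ℕ) (χ : (n : ℕ) → (↥(blockPerms n m) →* ℤˣ)) : Set (List ℕ) :=
  {l | ∃ (n : ℕ) (μ : Nat.Partition (n * m)), l = n :: μ.sortedParts ∧
    wreathHW ℂ (n * m) (χ n) (Weight.ofPartition (n * m) μ) ≠ ⊥}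

/-- **The list-coded plethysm language** `wreathLangL m χ` (codes under `encodingComposition`).
[cite: FischerIkenmeyer2020, §2 (eq. (2)) and §3 (Problems 2, 4; unary encodings)] -/
def wreathLangL (m : ℕ) (χ : (n : ℕ) → (↥(blockPerms n m) →* ℤˣ)) : Language Bool :=
  encodingComposition.toLanguage (wreathSetL m χ)

/-- Membership of `n :: μ.sortedParts` (unique decoding). [folklore] -/
theorem cons_sortedParts_mem_wreathSetL_iff {m : ℕ} (χ : (n : ℕ) → (↥(blockPerms n m) →* ℤˣ)) (n : ℕ)
    (μ : Nat.Partition (n * m)) :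
    n :: μ.sortedParts ∈ wreathSetL m χ ↔ wreathHW ℂ (n * m) (χ n) (Weight.ofPartition (n * m) μ) ≠ ⊥ := by
  constructor
  · rintro ⟨n', μ', he, h⟩
    obtain ⟨rfl, hs⟩ := List.cons_eq_cons.mp he
    rw [eq_of_sortedParts_eq hs]
    exact h
  · intro h; exact ⟨n, μ, rfl, h⟩

/-- Membership of a list with head `n`: its tail is the sorted parts of a member partition. [folklore] -/
theorem cons_mem_wreathSetL_iff {m : ℕ} (χ : (n : ℕ) → (↥(blockPerms n m) →* ℤˣ)) (n : ℕ) (L : List ℕ) :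
    n :: L ∈ wreathSetL m χ ↔ ∃ μ : Nat.Partition (n * m), L = μ.sortedParts ∧
      wreathHW ℂ (n * m) (χ n) (Weight.ofPartition (n * m) μ) ≠ ⊥ := by
  constructor
  · rintro ⟨n', μ', he, h⟩
    obtain ⟨rfl, hs⟩ := List.cons_eq_cons.mp he
    exact ⟨μ', hs, h⟩
  · rintro ⟨μ, rfl, h⟩
    exact ⟨n, μ, rfl, h⟩

/-- The empty list is in no `wreathSetL`. [folklore] -/
theorem nil_not_mem_wreathSetL {m : ℕ} (χ : (n : ℕ) → (↥(blockPerms n m) →* ℤˣ)) : ([] : List ℕ) ∉ wreathSetL m χ := by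
  rintro ⟨n, μ, he, -⟩
  exact List.cons_ne_nil _ _ he.symm

/-- `badL` is in no `wreathLangL`. [folklore] -/
theorem badL_not_mem_wreathLangL {m : ℕ} (χ : (n : ℕ) → (↥(blockPerms n m) →* ℤˣ)) :
    PlethCode.badL ∉ wreathLangL m χ := fun h =>
  nil_not_mem_wreathSetL χ ((encodingComposition.mem_toLanguage_iff _ _).1 h)

/-- A non-code is in no `wreathLangL`. [folklore] -/
theorem not_mem_wreathLangL_of_not_canon {m : ℕ} (χ : (n : ℕ) → (↥(blockPerms n m) →* ℤˣ)) {x : List Bool}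
    (hx : encodingComposition.encode (decComp x) ≠ x) : x ∉ wreathLangL m χ := fun h =>
  hx (encode_decComp_of_mem h)

/-! ### Base `m = 3` -/

section Base

variable (K : Point → Prop) [DecidablePred K] (χ : (n : ℕ) → (↥(blockPerms n 3) →* ℤˣ))

/-- **Bridge, open cone**: for a composition `λ`, the barrier-coded output `convF (encode λ)` lies in
`wreathLang 3 χ` iff the list-coded output `convLF (encode λ)` lies in `wreathLangL 3 χ` (both decode to
the pair `(|λ|/3, partition λ)`). [folklore] -/
theorem convF_mem_iff_convLF_mem (l : List ℕ) :
    PlethCode.convF (encodingComposition.encode l) ∈ wreathLang 3 χ ↔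
      PlethCode.convLF (encodingComposition.encode l) ∈ wreathLangL 3 χ := by
  rw [PlethCode.convF_encode, PlethCode.convLF_encode]
  by_cases hc : 3 ∣ l.sum ∧ PlethCode.AntiL l
  · obtain ⟨h3, ha⟩ := hc
    have hanti := PlethCode.antitone_listFn ha
    set n := l.sum / 3 with hn
    have hsum : l.sum = n * 3 := by rw [hn, Nat.div_mul_cancel h3]
    rw [if_pos ⟨h3, ha⟩, if_pos ⟨h3, ha⟩, ← PlethCode.encodePartition_partOfComp hanti n hsum, mem_wreathLang_iff,
      wreathLangL, encodingComposition.mem_toLanguage_iff, ← PlethCode.sortedParts_partOfComp hanti n hsum,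
      cons_sortedParts_mem_wreathSetL_iff]
  · rw [if_neg hc, if_neg hc]
    exact ⟨fun h => (nil_not_mem_wreathLang χ h).elim, fun h => (badL_not_mem_wreathLangL χ h).elim⟩

/-- **Bridge, closed cone, with transposition**: the barrier-coded `convF (encode λ)` lies in
`wreathLang 3 σₒ` iff the list-coded `convLTF (encode λ)` (pair `(n, λᵀ)`) lies in
`wreathLangL 3 (s·σₒ)` — Fact 1: the `σₒ`-multiplicity of `λ` is the `s·σₒ`-multiplicity of `λᵀ`.
[cite: FischerIkenmeyer2020, §2 (Fact 1)] -/
theorem convF_mem_iff_convLTF_mem (l : List ℕ) :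
    PlethCode.convF (encodingComposition.encode l) ∈ wreathLang 3 (fun n => (outerSign : ↥(blockPerms n 3) →* ℤˣ)) ↔
      PlethCode.convLTF (encodingComposition.encode l) ∈ wreathLangL 3 (fun n => innerSignChar n 3 true) := by
  rw [PlethCode.convF_encode, PlethCode.convLTF_encode]
  by_cases hc : 3 ∣ l.sum ∧ PlethCode.AntiL l
  · obtain ⟨h3, ha⟩ := hc
    have hanti := PlethCode.antitone_listFn ha
    set n := l.sum / 3 with hn
    have hsum : l.sum = n * 3 := by rw [hn, Nat.div_mul_cancel h3]
    set μ := PlethCode.partOfComp l n hsum with hμ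
    have htr : rowCounts (listFn (l.filter (· ≠ 0))) (l.filter (· ≠ 0)).length = μ.transpose.sortedParts := by
      rw [PlethCode.sortedParts_transpose_eq_rowCounts, PlethCode.sortedParts_partOfComp hanti n hsum]
    rw [if_pos ⟨h3, ha⟩, if_pos ⟨h3, ha⟩, ← PlethCode.encodePartition_partOfComp hanti n hsum, mem_wreathLang_iff,
      wreathLangL, encodingComposition.mem_toLanguage_iff, htr, cons_sortedParts_mem_wreathSetL_iff,
      innerSignChar_true]
    exact wreathHW_ne_bot_iff_transpose ℂ outerSign μ (Nat.Partition.card_parts_le_size _)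
      (Nat.Partition.card_parts_le_size _)
  · rw [if_neg hc, if_neg hc]
    exact ⟨fun h => (nil_not_mem_wreathLang _ h).elim, fun h => (badL_not_mem_wreathLangL _ h).elim⟩

/-- **The list-coded Karp reduction from (SKEW-)SYMMETRIC-2D-X-RAY** `conv ∘ redFn s`, for a
conversion `conv` whose membership agrees with that of `convF` (the bridges above).
[cite: FischerIkenmeyer2020, Lemmas 4–5] -/
theorem karpReducible_wreathLangL_of_cone (s : Bool) (χL : (n : ℕ) → (↥(blockPerms n 3) →* ℤˣ))
    (hK : ∀ a b c : ℕ, K (a, b, c) ↔ (Tomography.cmp s b a = true ∧ Tomography.cmp s c b = true))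
    (hlower : ∀ (P : Finset Point) (n N : ℕ), IsPyramid K P → P.card = n → (∀ p ∈ P, p.1 < N) →
      ∃ x ∈ wreathHW ℂ N (χ n) (fun i => (sumMarginal P i : ℤ)), x ≠ 0)
    (hupper : ∀ (n N : ℕ) (μ : Weight (Fin N)), wreathHW ℂ N (χ n) μ ≠ ⊥ →
      ∃ Q : Finset Point, (∀ q ∈ Q, K q) ∧ Q.card = n ∧ (∀ i : Fin N, (sumMarginal Q i : ℤ) = μ i) ∧
        ∀ i, N ≤ i → sumMarginal Q i = 0)
    (conv : List Bool → List Bool) (hconv : conv ∈ FP) (hbad : conv badCode = PlethCode.badL)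
    (hbridge : ∀ l, PlethCode.convF (encodingComposition.encode l) ∈ wreathLang 3 χ ↔
      conv (encodingComposition.encode l) ∈ wreathLangL 3 χL) :
    encodingComposition.toLanguage (symSetK K) ≤ₚ wreathLangL 3 χL := by
  refine ⟨conv ∘ redFn s, comp_mem_FP hconv (redFn_mem_FP s), fun x => ?_⟩
  show x ∈ encodingComposition.toLanguage (symSetK K) ↔ conv (redFn s x) ∈ wreathLangL 3 χL
  have hbad' : conv badCode ∉ wreathLangL 3 χL := by rw [hbad]; exact badL_not_mem_wreathLangL χL
  by_cases hx : encodingComposition.encode (decComp x) = x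
  · rw [← hx, redFn_encode, encodingComposition.mem_toLanguage_iff]
    by_cases hg : Good (decComp x)
    · rw [if_pos hg, coreF_encode s _ hK, ← hbridge]
      exact mem_symSetK_iff_convF_mem K χ hlower hupper hg
    · rw [if_neg hg]
      exact ⟨fun h => (hg (good_of_mem_symSetK h)).elim, fun h => (hbad' h).elim⟩
  · rw [redFn_of_not_canon s hx]
    exact ⟨fun h => (hx (encode_decComp_of_mem h)).elim, fun h => (hbad' h).elim⟩

end Base

/-- `convLF badCode = badL` (`badCode` codes `[1]`, and `3 ∤ 1`). [folklore] -/
theorem convLF_badCode : PlethCode.convLF badCode = PlethCode.badL := by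
  rw [badCode, badList, PlethCode.convLF_encode, if_neg (by decide)]

/-- `convLTF badCode = badL`. [folklore] -/
theorem convLTF_badCode : PlethCode.convLTF badCode = PlethCode.badL := by
  rw [badCode, badList, PlethCode.convLTF_encode, if_neg (by decide)]

/-- **SKEW-SYMMETRIC-2D-X-RAY `≤ₚ wreathLangL 3 s`** (open cone, `a_λ(n,3)`). [cite: FischerIkenmeyer2020, Lemmas 4–5 and Thm. 4] -/
theorem SKEWSYMTWODXRAY_karpReducible_wreathLangL :
    SKEWSYMTWODXRAY ≤ₚ wreathLangL 3 (fun n => innerSignChar n 3 false) := by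
  rw [SKEWSYMTWODXRAY, skewSymTwoDXRaySet_eq]
  refine karpReducible_wreathLangL_of_cone IsInOpenCone (fun n => restrSign n 3) true (fun n => innerSignChar n 3 false)
    (fun a b c => by simp [IsInOpenCone, Tomography.cmp]) (fun P n N hP hcard hN => ?_) (fun n N μ h => ?_)
    PlethCode.convLF PlethCode.convLF_mem_FP convLF_badCode (fun l => ?_)
  · exact exists_mem_wreathHW_of_isPyramid_open ℂ P hP hcard hN
  · obtain ⟨Q, hK, hcard, -, hS, hS0⟩ := exists_pointSet_of_wreathHW_ne_bot_open h
    exact ⟨Q, hK, hcard, hS, hS0⟩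
  · simp only [innerSignChar_false]
    exact convF_mem_iff_convLF_mem (fun n => restrSign n 3) l

/-- **SYMMETRIC-2D-X-RAY `≤ₚ wreathLangL 3 (s·σₒ)`** (closed cone, `b_λ(n,3)`, output transposed).
[cite: FischerIkenmeyer2020, Lemmas 4–5, Thm. 4 and Fact 1] -/
theorem SYMTWODXRAY_karpReducible_wreathLangL :
    SYMTWODXRAY ≤ₚ wreathLangL 3 (fun n => innerSignChar n 3 true) := by
  rw [SYMTWODXRAY, symTwoDXRaySet_eq]
  refine karpReducible_wreathLangL_of_cone IsInClosedCone (fun n => (outerSign : ↥(blockPerms n 3) →* ℤˣ)) false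
    (fun n => innerSignChar n 3 true) (fun a b c => by simp [IsInClosedCone, Tomography.cmp])
    (fun P n N hP hcard hN => ?_) (fun n N μ h => ?_)
    PlethCode.convLTF PlethCode.convLTF_mem_FP convLTF_badCode (fun l => convF_mem_iff_convLTF_mem l)
  · exact exists_mem_wreathHW_of_isPyramid_closed ℂ P hP hcard hN
  · obtain ⟨Q, hK, hcard, -, hS, hS0⟩ := exists_pointSet_of_wreathHW_ne_bot_closed h
    exact ⟨Q, hK, hcard, hS, hS0⟩

/-- **`wreathLangL 3 (isc b)` is NP-hard for both `b`.** [cite: FischerIkenmeyer2020, Thm. 1 (m = 3)] -/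
theorem isNPHard_wreathLangL_three (b : Bool) : IsNPHard (wreathLangL 3 fun n => innerSignChar n 3 b) := by
  cases b
  · exact fun L hL => PolyTimeKarpReducible.trans_holds (isNPHard_SKEWSYMTWODXRAY L hL)
      SKEWSYMTWODXRAY_karpReducible_wreathLangL
  · exact fun L hL => PolyTimeKarpReducible.trans_holds (isNPHard_SYMTWODXRAY L hL)
      SYMTWODXRAY_karpReducible_wreathLangL

/-! ### The step `m ↦ m + 1` -/

/-- **Too long a first row kills**: if the multiplicity of the letter `0` exceeds the number `n` of
blocks, there are no `χ`-isotypic highest-weight vectors when `χ` is odd on the transpositions inside the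
blocks (two equal letters in a block). This is why FI may assume "`λ` of width at most `n`" in Fact 2
(`a_λ(n, m) = 0` otherwise). [cite: FischerIkenmeyer2020, §4 (proof of Lemma 1: "If λᵀ is of width > n, then … a_λ(n, m) = 0")] -/
theorem wreathHW_eq_bot_of_lt {N n m : ℕ} (χ : ↥(blockPerms n m) →* ℤˣ)
    (hodd : ∀ (r : Fin n) (p p' : Fin m) (h : p ≠ p'),
      χ ⟨Equiv.swap (finProdFinEquiv (r, p)) (finProdFinEquiv (r, p')), swap_mem_blockPerms (by simp)⟩ = -1)
    (μ : Weight (Fin N)) (i : Fin N) (hlt : (n : ℤ) < μ i) : wreathHW ℂ N χ μ = ⊥ := by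
  classical
  rw [Submodule.eq_bot_iff]
  intro x hx
  funext u
  by_contra hu
  obtain ⟨hcontent, hno⟩ := content_eq_and_no_odd_of_apply_ne_zero hx hu
  have hci : (wordContent u i : ℤ) = μ i := hcontent i
  rw [wordContent_eq_sum_blocks] at hci
  -- some block has two places with the letter `i`
  have hex : ∃ r, 2 ≤ (Finset.univ.filter fun p : Fin m => u (finProdFinEquiv (r, p)) = i).card := by
    by_contra hall
    push Not at hall
    have : (∑ r : Fin n, (Finset.univ.filter fun p : Fin m => u (finProdFinEquiv (r, p)) = i).card) ≤ n := by
      calc _ ≤ ∑ _r : Fin n, 1 := Finset.sum_le_sum fun r _ => Nat.lt_succ_iff.mp (hall r)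
        _ = n := by simp
    have : (n : ℤ) < n := hlt.trans_le (by rw [← hci]; exact_mod_cast this)
    exact lt_irrefl _ this
  obtain ⟨r, hr⟩ := hex
  obtain ⟨p, hp, p', hp', hpp'⟩ := Finset.one_lt_card.mp hr
  have hpe := (Finset.mem_filter.mp hp).2
  have hpe' := (Finset.mem_filter.mp hp').2
  refine hno ⟨Equiv.swap (finProdFinEquiv (r, p)) (finProdFinEquiv (r, p')), swap_mem_blockPerms (by simp)⟩
    (funext fun q => Equiv.apply_swap_eq_self (hpe.trans hpe'.symm) q) (hodd r p p' hpp')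

/-- The `m + 1`-side and the `m`-side memberships for `n = 0` agree (both hold: the prepend
equivalence at `n = 0`). [folklore] -/
theorem wreathHW_zero_iff {m : ℕ} [NeZero m] (b : Bool) (μ : Nat.Partition (0 * m)) (μ' : Nat.Partition (0 * (m + 1))) :
    wreathHW ℂ (0 * m) (innerSignChar 0 m b) (Weight.ofPartition (0 * m) μ) ≠ ⊥ ↔
      wreathHW ℂ (0 * (m + 1)) (innerSignChar 0 (m + 1) (!b)) (Weight.ofPartition (0 * (m + 1)) μ') ≠ ⊥ := by
  have hμ0 : Weight.ofPartition 0 μ = fun _ => 0 := PlethCode.ofPartition_of_size_zero (by simp) μ 0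
  have h1 := wreathHW_innerSignChar_ne_bot_iff_cons (k := ℂ) (n := 0) (m := m) (M := 0) b (Weight.ofPartition 0 μ)
  have hcons : (Fin.cons ((0 : ℕ) : ℤ) (Weight.ofPartition 0 μ) : Weight (Fin 1)) = Weight.ofPartition 1 μ' := by
    rw [PlethCode.ofPartition_of_size_zero (by simp) μ' 1, hμ0]
    funext i
    refine Fin.cases ?_ (fun j => j.elim0) i
    rfl
  have hc0 : μ.parts.card ≤ 0 := (Nat.Partition.card_parts_le_size μ).trans (by simp)
  have hc0' : μ'.parts.card ≤ 0 := (Nat.Partition.card_parts_le_size μ').trans (by simp)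
  rw [wreathHW_ne_bot_iff_of_card_le ℂ (innerSignChar 0 m b) μ (N := 0 * m) (N' := 0)
    (Nat.Partition.card_parts_le_size μ) hc0, h1, hcons]
  exact wreathHW_ne_bot_iff_of_card_le ℂ (innerSignChar 0 (m + 1) (!b)) μ' (N := 1) (N' := 0 * (m + 1))
    (hc0'.trans (Nat.zero_le 1)) (Nat.Partition.card_parts_le_size μ')

/-- **The Karp reduction of Lemma 1 / Fact 2 on list codes**: `prependF` reduces
`wreathLangL m (isc b)` to `wreathLangL (m+1) (isc !b)`. [cite: FischerIkenmeyer2020, §4 (Lemma 1, Fact 2)] -/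
theorem wreathLangL_karpReducible_succ (m : ℕ) [NeZero m] (b : Bool) :
    wreathLangL m (fun n => innerSignChar n m b) ≤ₚ wreathLangL (m + 1) (fun n => innerSignChar n (m + 1) (!b)) := by
  refine ⟨PlethCode.prependF, PlethCode.prependF_mem_FP, fun x => ?_⟩
  show x ∈ wreathLangL m _ ↔ PlethCode.prependF x ∈ wreathLangL (m + 1) _
  by_cases hx : encodingComposition.encode (decComp x) = x
  · rw [← hx]
    set l := decComp x with hl
    rw [wreathLangL, wreathLangL, encodingComposition.mem_toLanguage_iff]
    rcases l with _ | ⟨n, L⟩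
    · rw [PlethCode.prependF_encode_nil, encodingComposition.mem_toLanguage_iff]
      exact ⟨fun h => (nil_not_mem_wreathSetL _ h).elim, fun h => (nil_not_mem_wreathSetL _ h).elim⟩
    · rcases Nat.eq_zero_or_pos n with rfl | hn
      · -- `n = 0`: identity; both sides say `L = []` (and hold then)
        rw [PlethCode.prependF_encode_zero_cons, encodingComposition.mem_toLanguage_iff, cons_mem_wreathSetL_iff,
          cons_mem_wreathSetL_iff]
        constructor
        · rintro ⟨μ, hL, hW⟩
          have hL' : L = [] := by
            rw [hL]; exact List.eq_nil_of_length_eq_zero (by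
              rw [Nat.Partition.length_sortedParts]; have := Nat.Partition.card_parts_le_size μ; omega)
          let μ' : Nat.Partition (0 * (m + 1)) := ⟨0, by simp, by simp⟩
          refine ⟨μ', ?_, (wreathHW_zero_iff b μ μ').mp hW⟩
          rw [hL']; symm
          exact List.eq_nil_of_length_eq_zero (by
            rw [Nat.Partition.length_sortedParts]; have := Nat.Partition.card_parts_le_size μ'; omega)
        · rintro ⟨μ', hL, hW⟩
          have hL' : L = [] := by
            rw [hL]; exact List.eq_nil_of_length_eq_zero (by
              rw [Nat.Partition.length_sortedParts]; have := Nat.Partition.card_parts_le_size μ'; omega)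
          let μ : Nat.Partition (0 * m) := ⟨0, by simp, by simp⟩
          refine ⟨μ, ?_, (wreathHW_zero_iff b μ μ').mpr hW⟩
          rw [hL']; symm
          exact List.eq_nil_of_length_eq_zero (by
            rw [Nat.Partition.length_sortedParts]; have := Nat.Partition.card_parts_le_size μ; omega)
      · -- `n > 0`
        rw [PlethCode.prependF_encode_cons hn.ne', cons_mem_wreathSetL_iff]
        by_cases hle : listFn L 0 ≤ n
        · rw [if_pos hle, encodingComposition.mem_toLanguage_iff, cons_mem_wreathSetL_iff]
          constructor
          · rintro ⟨μ, rfl, hW⟩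
            refine ⟨PlethCode.consPart hn μ, (PlethCode.sortedParts_consPart hn μ hle).symm, ?_⟩
            have h1 := (wreathHW_innerSignChar_ne_bot_iff_cons (k := ℂ) (M := n * m) b (Weight.ofPartition (n * m) μ)).mp hW
            rw [← PlethCode.ofPartition_consPart hn μ hle] at h1
            exact (wreathHW_ne_bot_iff_of_card_le ℂ _ (PlethCode.consPart hn μ)
              (by
                have := Nat.Partition.card_parts_le_size μ
                change (n ::ₘ μ.parts).card ≤ n * m + 1
                rw [Multiset.card_cons]; omega)
              (Nat.Partition.card_parts_le_size _)).mp h1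
          · rintro ⟨μ', hL, hW'⟩
            obtain ⟨μ, hμ⟩ := PlethCode.exists_tail_partition μ' hL.symm
            refine ⟨μ, hμ.symm, ?_⟩
            have hle' : listFn μ.sortedParts 0 ≤ n := by rw [hμ]; exact hle
            have hμ' : μ' = PlethCode.consPart hn μ :=
              eq_of_sortedParts_eq (by rw [PlethCode.sortedParts_consPart hn μ hle', hμ, hL])
            subst hμ'
            have h1 := (wreathHW_ne_bot_iff_of_card_le ℂ _ (PlethCode.consPart hn μ)
              (by
                have := Nat.Partition.card_parts_le_size μ
                change (n ::ₘ μ.parts).card ≤ n * m + 1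
                rw [Multiset.card_cons]; omega)
              (Nat.Partition.card_parts_le_size _)).mpr hW'
            rw [PlethCode.ofPartition_consPart hn μ hle'] at h1
            exact (wreathHW_innerSignChar_ne_bot_iff_cons (k := ℂ) (M := n * m) b (Weight.ofPartition (n * m) μ)).mpr h1
        · rw [if_neg hle]
          constructor
          · rintro ⟨μ, rfl, hW⟩
            exfalso
            have hN : 0 < n * m := by
              have h0 : 0 < listFn μ.sortedParts 0 := by omega
              have : 0 < μ.sortedParts.length := by
                by_contra h; rw [not_lt, Nat.le_zero] at h
                rw [listFn_of_le (by omega)] at h0; exact lt_irrefl _ h0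
              have := Nat.Partition.card_parts_le_size μ
              rw [← Nat.Partition.length_sortedParts] at this
              omega
            refine hW (wreathHW_eq_bot_of_lt (innerSignChar n m b) (fun r p p' h => innerSignChar_swap b r h) _
              ⟨0, hN⟩ ?_)
            simp only [Weight.ofPartition]
            rw [not_le] at hle
            have : (μ.sortedParts.getD 0 0 : ℤ) = ((listFn μ.sortedParts 0 : ℕ) : ℤ) := rfl
            rw [this]
            exact_mod_cast hle
          · intro h
            exact (badL_not_mem_wreathLangL _ h).elim
  · -- non-code
    constructor
    · intro h; exact (not_mem_wreathLangL_of_not_canon _ hx h).elim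
    · intro h
      by_cases h0 : PlethCode.item0F x = []
      · rw [PlethCode.prependF_of_item0F_nil h0] at h
        exact (not_mem_wreathLangL_of_not_canon _ hx h).elim
      · rw [PlethCode.prependF_of_not_canon hx h0] at h
        exact (badL_not_mem_wreathLangL _ h).elim

/-- **`wreathLangL (k+3) (isc b)` is NP-hard for every `k` and both `b`** (induction on `k` by the
prepend reductions, from the two bases at `m = 3`). [cite: FischerIkenmeyer2020, Thm. 1 with Lemma 1] -/
theorem isNPHard_wreathLangL_add_three (k : ℕ) (b : Bool) :
    IsNPHard (wreathLangL (k + 3) fun n => innerSignChar n (k + 3) b) := by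
  induction k generalizing b with
  | zero => exact isNPHard_wreathLangL_three b
  | succ k ih =>
    cases b
    · exact fun L hL => PolyTimeKarpReducible.trans_holds (ih true L hL) (wreathLangL_karpReducible_succ (k + 3) true)
    · exact fun L hL => PolyTimeKarpReducible.trans_holds (ih false L hL) (wreathLangL_karpReducible_succ (k + 3) false)

/-! ### The exit to the barrier's languages -/

/-- Unique decoding of PLETHYSMPOSITIVITY(`m`) codes. [folklore] -/
theorem mem_plethysmPositivityFixed_iff {m : ℕ} (n : ℕ) (lam : Nat.Partition (n * m)) :
    encodePartition lam ++ unaryNat n ∈ PlethysmPositivityFixed m ↔ 0 < plethysmCoeffOfPartition ℂ (n * m) m lam := by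
  constructor
  · rintro ⟨n', lam', he, h⟩
    obtain ⟨hs, hu⟩ := encodePartition_append_inj he
    have hn : n = n' := unaryNat_injective hu
    subst hn
    have : lam = lam' := eq_of_sortedParts_eq hs
    subst this
    exact h
  · intro h; exact ⟨n, lam, rfl, h⟩

/-- The empty word is not a PLETHYSMPOSITIVITY(`m`) instance. [folklore] -/
theorem nil_not_mem_plethysmPositivityFixed (m : ℕ) : ([] : List Bool) ∉ PlethysmPositivityFixed m := by
  rintro ⟨n, lam, he, -⟩
  have := congrArg List.length he
  simp [unaryNat] at this

/-- The empty word is not a PLETHYSMPOSITIVITY instance. [folklore] -/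
theorem nil_not_mem_plethysmPositivity : ([] : List Bool) ∉ PlethysmPositivity := by
  rintro ⟨n, m, lam, he, -⟩
  have := congrArg List.length he
  simp [unaryNat] at this

/-- **Membership correspondence of the exit**: for `μ ⊢ n·m` (`m ≠ 0`), `(μᵀ, n)` is a
PLETHYSMPOSITIVITY(`m`) instance iff the `s`-isotypic highest-weight space of weight `μ` is nonzero
(Fact 1 in the form of `PlethysmWordModel.lean`, `μᵀᵀ = μ`). [cite: FischerIkenmeyer2020, §2 (Fact 1) and Lemma 4 ("(λᵀ, n) is returned")] -/
theorem encode_transpose_mem_iff {n m : ℕ} (hm : m ≠ 0) (μ : Nat.Partition (n * m)) :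
    encodePartition μ.transpose ++ unaryNat n ∈ PlethysmPositivityFixed m ↔
      wreathHW ℂ (n * m) (restrSign n m) (Weight.ofPartition (n * m) μ) ≠ ⊥ := by
  rw [mem_plethysmPositivityFixed_iff,
    plethysmCoeffOfPartition_pos_iff_wreathHW_transpose_ne_bot ℂ (n * m) hm μ.transpose
      (Nat.Partition.card_parts_le_size _) (N' := n * m)
      (by rw [Nat.Partition.transpose_transpose]; exact Nat.Partition.card_parts_le_size _),
    Nat.Partition.transpose_transpose]

/-- The output of `transOutF m` on the code of `n :: μ.sortedParts` is the barrier code of `(μᵀ, n)`.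
[cite: FischerIkenmeyer2020, Lemma 4 (proof)] -/
theorem transOutF_encode_sortedParts {n m : ℕ} (μ : Nat.Partition (n * m)) :
    PlethCode.transOutF m (encodingComposition.encode (n :: μ.sortedParts)) =
      encodePartition μ.transpose ++ unaryNat n := by
  rw [PlethCode.transOutF_encode_cons, if_pos (PlethCode.validL_sortedParts μ), encodePartition,
    PlethCode.sortedParts_transpose_eq_rowCounts]

/-- **The exit `wreathLangL m s ≤ₚ PlethysmPositivityFixed m`** (`m ≠ 0`), by `transOutF m`.
[cite: FischerIkenmeyer2020, Lemma 4 and Fact 1] -/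
theorem wreathLangL_karpReducible_plethysmPositivityFixed (m : ℕ) [NeZero m] :
    wreathLangL m (fun n => innerSignChar n m false) ≤ₚ PlethysmPositivityFixed m := by
  refine ⟨PlethCode.transOutF m, PlethCode.transOutF_mem_FP m, fun x => ?_⟩
  show x ∈ wreathLangL m _ ↔ PlethCode.transOutF m x ∈ PlethysmPositivityFixed m
  by_cases hx : encodingComposition.encode (decComp x) = x
  · rw [← hx]
    set l := decComp x with hl
    rw [wreathLangL, encodingComposition.mem_toLanguage_iff]
    rcases l with _ | ⟨n, L⟩
    · rw [PlethCode.transOutF_encode_nil]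
      exact ⟨fun h => (nil_not_mem_wreathSetL _ h).elim, fun h => (nil_not_mem_plethysmPositivityFixed m h).elim⟩
    · rw [cons_mem_wreathSetL_iff]
      constructor
      · rintro ⟨μ, rfl, hW⟩
        rw [transOutF_encode_sortedParts, encode_transpose_mem_iff (NeZero.ne m)]
        simpa only [innerSignChar_false] using hW
      · intro h
        rw [PlethCode.transOutF_encode_cons] at h
        by_cases hv : PlethCode.ValidL m n L
        · obtain ⟨ha, hpos, hsum⟩ := hv
          have hsum' : L.sum = n * m := by rw [hsum, Nat.mul_comm]
          set μ := PlethCode.partOfList L hpos (n * m) hsum' with hμ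
          have hsp : μ.sortedParts = L := PlethCode.sortedParts_partOfList ha hpos _ hsum'
          refine ⟨μ, hsp.symm, ?_⟩
          rw [if_pos (show PlethCode.ValidL m n L from ⟨ha, hpos, hsum⟩), ← hsp,
            ← PlethCode.sortedParts_transpose_eq_rowCounts, ← encodePartition, encode_transpose_mem_iff (NeZero.ne m)] at h
          simpa only [innerSignChar_false] using h
        · rw [if_neg hv] at h
          exact (nil_not_mem_plethysmPositivityFixed m h).elim
  · rw [PlethCode.transOutF_of_not_canon m hx]
    exact ⟨fun h => (not_mem_wreathLangL_of_not_canon _ hx h).elim, fun h => (nil_not_mem_plethysmPositivityFixed m h).elim⟩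

/-- **PLETHYSMPOSITIVITY(`m`) is NP-hard for every `m ≥ 3`.** [cite: FischerIkenmeyer2020, Thm. 1] -/
theorem isNPHard_plethysmPositivityFixed {m : ℕ} (hm : 3 ≤ m) : IsNPHard (PlethysmPositivityFixed m) := by
  obtain ⟨k, rfl⟩ : ∃ k, m = k + 3 := ⟨m - 3, by omega⟩
  exact fun L hL => PolyTimeKarpReducible.trans_holds (isNPHard_wreathLangL_add_three k false L hL)
    (wreathLangL_karpReducible_plethysmPositivityFixed (k + 3))

/-- The exit machine to PLETHYSMPOSITIVITY: the barrier code of `(μᵀ, n)` followed by `unaryNat 3`.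
[cite: FischerIkenmeyer2020, Thm. 1 ("In particular")] -/
def exit3F : List Bool → List Bool := iteFn (PlethCode.validT 3) (fun w => PlethCode.outTF w ++ unaryNat 3) fun _ => []

/-- `exit3F ∈ FP`. [folklore] -/
theorem exit3F_mem_FP : exit3F ∈ FP :=
  iteFn_mem_FP (PlethCode.validT_mem_FP 3) (append_mem_FP PlethCode.outTF_mem_FP (const_mem_FP _)) (const_mem_FP _)

/-- Value of the exit machine: `transOutF 3 w ++ unaryNat 3` on valid inputs, `ε` otherwise. [folklore] -/
theorem exit3F_eq (w : List Bool) :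
    exit3F w = if PlethCode.transOutF 3 w = [] then [] else PlethCode.transOutF 3 w ++ unaryNat 3 := by
  obtain ⟨bb, hb⟩ : ∃ bb, PlethCode.validT 3 w = [bb] :=
    (oneBit_andFn oneBit_isCanonFn (oneBit_andFn PlethCode.oneBit_hdrT (oneBit_andFn (PlethCode.oneBit_antiT.comp _)
      (oneBit_andFn (PlethCode.oneBit_noZeroT.comp _) (PlethCode.oneBit_sumEqT 3))))) w
  rw [exit3F, PlethCode.transOutF, iteFn_apply hb, iteFn_apply hb]
  cases bb
  · simp
  · simp only [↓reduceIte]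
    rw [if_neg]
    rw [PlethCode.outTF, PlethCode.trCode0F, PlethCode.sfxF]
    simp

/-- Unique decoding of PLETHYSMPOSITIVITY codes ending in `unaryNat 3`. [folklore] -/
theorem mem_plethysmPositivity_iff_three (n : ℕ) (lam : Nat.Partition (n * 3)) :
    encodePartition lam ++ unaryNat n ++ unaryNat 3 ∈ PlethysmPositivity ↔ 0 < plethysmCoeffOfPartition ℂ (n * 3) 3 lam := by
  constructor
  · rintro ⟨n', m', lam', he, h⟩
    rw [List.append_assoc, List.append_assoc] at he
    obtain ⟨hs, hu⟩ := encodePartition_append_inj he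
    have hu' : List.replicate n true ++ false :: unaryNat 3 = List.replicate n' true ++ false :: unaryNat m' := by
      simpa [unaryNat, List.append_assoc] using hu
    obtain ⟨hn, hu3⟩ := replicate_true_append_inj hu'
    subst hn
    have hm : 3 = m' := unaryNat_injective hu3
    subst hm
    have : lam = lam' := eq_of_sortedParts_eq hs
    subst this
    exact h
  · intro h; exact ⟨n, 3, lam, rfl, h⟩

/-- **The exit `wreathLangL 3 s ≤ₚ PlethysmPositivity`**, by `exit3F`. [cite: FischerIkenmeyer2020, Thm. 1 ("In particular")] -/
theorem wreathLangL_three_karpReducible_plethysmPositivity :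
    wreathLangL 3 (fun n => innerSignChar n 3 false) ≤ₚ PlethysmPositivity := by
  refine ⟨exit3F, exit3F_mem_FP, fun x => ?_⟩
  show x ∈ wreathLangL 3 _ ↔ exit3F x ∈ PlethysmPositivity
  rw [exit3F_eq]
  by_cases hx : encodingComposition.encode (decComp x) = x
  · rw [← hx]
    set l := decComp x with hl
    rw [wreathLangL, encodingComposition.mem_toLanguage_iff]
    rcases l with _ | ⟨n, L⟩
    · rw [PlethCode.transOutF_encode_nil, if_pos rfl]
      exact ⟨fun h => (nil_not_mem_wreathSetL _ h).elim, fun h => (nil_not_mem_plethysmPositivity h).elim⟩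
    · rw [cons_mem_wreathSetL_iff]
      constructor
      · rintro ⟨μ, rfl, hW⟩
        rw [transOutF_encode_sortedParts, if_neg (by simp [unaryNat]), mem_plethysmPositivity_iff_three,
          ← mem_plethysmPositivityFixed_iff, encode_transpose_mem_iff three_ne_zero]
        simpa only [innerSignChar_false] using hW
      · intro h
        by_cases hv : PlethCode.ValidL 3 n L
        · obtain ⟨ha, hpos, hsum⟩ := hv
          have hsum' : L.sum = n * 3 := by rw [hsum, Nat.mul_comm]
          set μ := PlethCode.partOfList L hpos (n * 3) hsum' with hμ
          have hsp : μ.sortedParts = L := PlethCode.sortedParts_partOfList ha hpos _ hsum'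
          have hT : PlethCode.transOutF 3 (encodingComposition.encode (n :: L)) = encodePartition μ.transpose ++ unaryNat n := by
            rw [← hsp]; exact transOutF_encode_sortedParts μ
          rw [hT, if_neg (by simp [unaryNat]), mem_plethysmPositivity_iff_three, ← mem_plethysmPositivityFixed_iff,
            encode_transpose_mem_iff three_ne_zero] at h
          refine ⟨μ, hsp.symm, ?_⟩
          simpa only [innerSignChar_false] using h
        · have hT : PlethCode.transOutF 3 (encodingComposition.encode (n :: L)) = [] := by
            rw [PlethCode.transOutF_encode_cons, if_neg hv]
          rw [hT, if_pos rfl] at h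
          exact (nil_not_mem_plethysmPositivity h).elim
  · rw [PlethCode.transOutF_of_not_canon 3 hx, if_pos rfl]
    exact ⟨fun h => (not_mem_wreathLangL_of_not_canon _ hx h).elim, fun h => (nil_not_mem_plethysmPositivity h).elim⟩

/-- **PLETHYSMPOSITIVITY is NP-hard.** [cite: FischerIkenmeyer2020, Thm. 1 ("In particular")] -/
theorem isNPHard_plethysmPositivity : IsNPHard PlethysmPositivity := fun L hL =>
  PolyTimeKarpReducible.trans_holds (isNPHard_wreathLangL_add_three 0 false L hL)
    wreathLangL_three_karpReducible_plethysmPositivity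

/-! ### The discharges -/

/-- **Discharge of `FischerIkenmeyer2020_plethysmNPHard`** (`KroneckerPositivityHardness.lean`):
Fischer–Ikenmeyer 2020, Thm. 1 — PLETHYSMPOSITIVITY(`m`) is NP-hard for every fixed `m ≥ 3`, and
PLETHYSMPOSITIVITY is NP-hard — for the tree's unary languages and Karp notion `IsNPHard`, proved along
the printed chain (Fig. 2, Lemmas 4–8, Thm. 4; Lemma 1 with Facts 1–2) in the word model of `V^{⊗nm}`.
[cite: FischerIkenmeyer2020, Thm. 1] -/
theorem FischerIkenmeyer2020_plethysmNPHard_holds : FischerIkenmeyer2020_plethysmNPHard :=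
  ⟨fun _ hm => isNPHard_plethysmPositivityFixed hm, isNPHard_plethysmPositivity⟩

/-- **Discharge of the barrier fact `KroneckerPlethysmHardness`**: positivity of Kronecker
coefficients (IMW 2017, Thm. 1.1: `IMW2017_kroneckerNPHard_holds`, `KroneckerXRayMachine.lean`) and of
plethysm coefficients (FI 2020, Thm. 1, above) is NP-hard.
[cite: IkenmeyerMulmuleyWalter2017, Thm. 1.1] [cite: FischerIkenmeyer2020, Thm. 1] -/
theorem KroneckerPlethysmHardness_holds : KroneckerPlethysmHardness :=
  kroneckerPlethysmHardness_of_plethysm FischerIkenmeyer2020_plethysmNPHard_holds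

end Literature.Barriers.ValiantsHypothesis
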